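import Literature.Computability.Cryptography.LWEAmplifyQuery
import Literature.Computability.Cryptography.LWESearchToDecisionMachine
import HarnessLib

/-!
# The average-case-to-worst-case bridge for search-LWE, II: the answer map of one attempt

Topic `Computability/Cryptography` (LWE), grouping namespace `LWE.AmpBricks`, continuing
`LWEAmplifyQuery.lean` (the query generator `queryZ` of attempt `j`: batch `j` shifted by the
vector `t` read off the coins, Regev 2009, proof of Lemma 4.1). Attempt `j` feeds that query to the
given average-case solver and reads the solver's measured output register `y` through the total
decoder `decodeSecret n q` of `LWEHardness.lean` (by which `SearchLWESolves` judges it); if the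
solver found the secret of the SHIFTED instance, `decodeSecret n q y = s + t`, so the attempt must
return `decodeSecret n q y − t`. This file is the classical post-processor of the attempt, as ONE
total string function on `w = ⟨z, y⟩` (`z = ⟨x, eⱼ ++ c⟩` the root input of the attempt, the
first pair component of the wrapped post-processor's argument `⟨input, answer⟩` of
`QuantumComplexity/CWrap*.lean`):

* `secFrameP` (one coordinate: read item `i'` of the raw body of `y` by iterated `sndF` —
  `nthLF` on ARBITRARY strings, `dropLF_record` — canonicalise it (`canonF`, Mathlib's `decodeNat`
  reading of non-canonical numerals, exactly as `decodeSecret` does), subtract `tᵢ'` mod `q`; the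
  junk secret `0` when the unary length field of `y` is not `1ⁿ`), the `appF`-fold `secFramesW`
  and **`answerG`** `= ⟨⟨1ⁿ, frames⟩, ε⟩`, all in `FP`;
* **`answerG_apply`**: `answerG ⟨zOf S j c, y⟩ = encodeSecret (decodeSecret n q y − shiftOfCoins n q c)`
  for EVERY string `y` (so the output is the CANONICAL code of a secret, whatever the solver wrote,
  and it is `encodeSecret s` exactly when the solver's answer decodes to `s + t`,
  `answerG_apply_of_decode`).

## References

* O. Regev, *On lattices, learning with errors, random linear codes, and cryptography*, J. ACM 56
  (2009), art. 34, §4, proof of Lemma 4.1 (held: arXiv:2401.03703, p. 23). [cite: Regev2009, §4 Lemma 4.1 (proof)]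
* S. Arora, B. Barak, *Computational Complexity: A Modern Approach*, CUP 2009, §1.3. [cite: AroraBarak2009, §1.3]
-/

noncomputable section

namespace Literature.Computability.Cryptography

namespace LWE

namespace AmpBricks

open _root_.Computability Polynomial Literature.Computability.Complexity Brick Plumb HashBricks
open RegevBricks (rootU ipU rootU_mem_FP ipU_mem_FP loopRec loopRec_mem_FP loopRec_apply frames_ofFn_eq_ccat')

set_option synthInstance.maxSize 512

/-! ### The bricks -/

section Defs

/-- The root `z` of the argument `w = ⟨z, y⟩` of the piece context `p = ⟨w, 1^{i'}⟩`. [folklore] -/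
def zP : List Bool → List Bool := fstF ∘ fstF
/-- The answer `y`. [folklore] -/
def yP : List Bool → List Bool := sndF ∘ fstF
/-- The unary length field of the answer's secret code. [folklore] -/
def secCntP : List Bool → List Bool := fstF ∘ fstF ∘ yP
/-- The raw body (list of items) of the answer's secret code. [folklore] -/
def secBodyP : List Bool → List Bool := sndF ∘ fstF ∘ yP
/-- **Item `i'` of the raw body**, read by `i'` iterated tails (total). [folklore] -/
def itemP : List Bool → List Bool := nthLF ∘ fanoutFn zP (fanoutFn (lenBinF ∘ ipU) secBodyP)
/-- The canonical numeral of the item (Mathlib's `decodeNat` reading, as in `decodeSecret`). [folklore] -/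
def sValP : List Bool → List Bool := canonF ∘ itemP
/-- **The length test `[|unary field| = n]`** of `decodeSecret`. [folklore] -/
def condP : List Bool → List Bool := eqValFn ∘ fanoutFn (lenBinF ∘ secCntP) (bnZ ∘ zP)
/-- The item reduced mod `q` if the length test passes, else the empty numeral (`0`). [folklore] -/
def sModP : List Bool → List Bool := iteFn condP (remFn ∘ fanoutFn sValP (bqZ ∘ zP)) fun _ => []
/-- **`bin (s'ᵢ' − tᵢ').val`** `= bin ((q − tᵢ'.val + s'ᵢ'.val) mod q)`. [cite: Regev2009, §4 Lemma 4.1 (proof: undo the shift)] -/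
def vP : List Bool → List Bool :=
  remFn ∘ fanoutFn (addFn ∘ fanoutFn (subFn ∘ fanoutFn (bqZ ∘ zP) tvalU) sModP) (bqZ ∘ zP)
/-- The one-item frame `⟨bin vᵢ', ε⟩`. [folklore] -/
def secFrameP : List Bool → List Bool := fanoutFn vP fun _ => []
/-- **The framed coordinates**: an `appF`-fold over `i' < n` (context `w`). [folklore] -/
def secFramesW : List Bool → List Bool := sndPow 2 ∘ foldLoop appF (clipF 2 secFrameP) X ∘ loopRec (bnZ ∘ fstF)
/-- **The answer map**: the canonical code `⟨⟨1ⁿ, frames⟩, ε⟩` of `decodeSecret n q y − t`.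
[cite: Regev2009, §4 Lemma 4.1 (proof)] -/
def answerG : List Bool → List Bool := fanoutFn (fanoutFn (onesNZ ∘ fstF) secFramesW) fun _ => []

end Defs

/-! ### Polynomial time -/

section FP

/-- `zP ∈ FP`. [folklore] -/
theorem zP_mem_FP : zP ∈ FP := comp_mem_FP fstF_mem_FP fstF_mem_FP
/-- `yP ∈ FP`. [folklore] -/
theorem yP_mem_FP : yP ∈ FP := comp_mem_FP sndF_mem_FP fstF_mem_FP
/-- `secCntP ∈ FP`. [folklore] -/
theorem secCntP_mem_FP : secCntP ∈ FP := comp_mem_FP fstF_mem_FP (comp_mem_FP fstF_mem_FP yP_mem_FP)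
/-- `secBodyP ∈ FP`. [folklore] -/
theorem secBodyP_mem_FP : secBodyP ∈ FP := comp_mem_FP sndF_mem_FP (comp_mem_FP fstF_mem_FP yP_mem_FP)
/-- `itemP ∈ FP`. [folklore] -/
theorem itemP_mem_FP : itemP ∈ FP :=
  comp_mem_FP nthLF_mem_FP (fanoutFn_mem_FP zP_mem_FP (fanoutFn_mem_FP (comp_mem_FP lenBinF_mem_FP ipU_mem_FP) secBodyP_mem_FP))
/-- `sValP ∈ FP`. [folklore] -/
theorem sValP_mem_FP : sValP ∈ FP := comp_mem_FP canonF_mem_FP itemP_mem_FP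
/-- `condP ∈ FP`. [folklore] -/
theorem condP_mem_FP : condP ∈ FP :=
  comp_mem_FP eqValFn_mem_FP (fanoutFn_mem_FP (comp_mem_FP lenBinF_mem_FP secCntP_mem_FP) (comp_mem_FP bnZ_mem_FP zP_mem_FP))
/-- `condP` is one-bit. [folklore] -/
theorem oneBit_condP : OneBit condP := oneBit_eqValFn.comp _
/-- `sModP ∈ FP`. [folklore] -/
theorem sModP_mem_FP : sModP ∈ FP :=
  iteFn_mem_FP condP_mem_FP (comp_mem_FP remFn_mem_FP (fanoutFn_mem_FP sValP_mem_FP (comp_mem_FP bqZ_mem_FP zP_mem_FP)))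
    (const_mem_FP _)
/-- `vP ∈ FP`. [folklore] -/
theorem vP_mem_FP : vP ∈ FP :=
  comp_mem_FP remFn_mem_FP (fanoutFn_mem_FP
    (comp_mem_FP addFn_mem_FP (fanoutFn_mem_FP
      (comp_mem_FP subFn_mem_FP (fanoutFn_mem_FP (comp_mem_FP bqZ_mem_FP zP_mem_FP) tvalU_mem_FP)) sModP_mem_FP))
    (comp_mem_FP bqZ_mem_FP zP_mem_FP))
/-- `secFrameP ∈ FP`. [folklore] -/
theorem secFrameP_mem_FP : secFrameP ∈ FP := fanoutFn_mem_FP vP_mem_FP (const_mem_FP _)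
/-- `secFramesW ∈ FP`. [folklore] -/
theorem secFramesW_mem_FP : secFramesW ∈ FP :=
  comp_mem_FP (sndPow_mem_FP 2) (comp_mem_FP (foldLoop_clipF_mem_FP 2 appF_mem_FP length_appF_le secFrameP_mem_FP X)
    (loopRec_mem_FP (comp_mem_FP bnZ_mem_FP fstF_mem_FP)))
/-- **`answerG ∈ FP`.** [cite: AroraBarak2009, §1.3] -/
theorem answerG_mem_FP : answerG ∈ FP :=
  fanoutFn_mem_FP (fanoutFn_mem_FP (comp_mem_FP onesNZ_mem_FP fstF_mem_FP) secFramesW_mem_FP) (const_mem_FP _)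

end FP

/-! ### Values -/

section Values

variable {n q m : ℕ} (S : Fin (K0 n * m) → (Fin n → ZMod q) × ZMod q) (j : ℕ) (c y : List Bool)

/-- The argument `w = ⟨z, y⟩` of the answer map. [folklore] -/
def wOf : List Bool := boolPair (zOf S j c) y

/-- `wOf` unfolded. [folklore] -/
theorem wOf_eq : wOf S j c y = boolPair (zOf S j c) y := rfl

/-- The piece context of coordinate `i'`. [folklore] -/
def pOf (i' : ℕ) : List Bool := boolPair (wOf S j c y) (ones i')

variable (i' : ℕ)

/-- Root of the piece context. [folklore] -/
@[simp] theorem zP_pOf : zP (pOf S j c y i') = zOf S j c := by simp [zP, pOf, wOf]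
/-- Answer of the piece context. [folklore] -/
@[simp] theorem yP_pOf : yP (pOf S j c y i') = y := by simp [yP, pOf, wOf]
/-- Index of the piece context. [folklore] -/
@[simp] theorem ipU_pOf : ipU (pOf S j c y i') = ones i' := sndF_boolPair _ _
/-- The piece context IS a depth-two context of the query generator (root `z`, middle field `y`). [folklore] -/
theorem rootU_pOf : rootU (pOf S j c y i') = zOf S j c := by simp [rootU, pOf, wOf]

/-- **The secret the answer decodes to**, coordinatewise: Mathlib's `decodeNat` of item `i'` of the
raw body if the unary field has length `n`, else `0` (`S2D.decodeSecret_eq`). [folklore] -/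
def secOf (n q : ℕ) (y : List Bool) (i' : ℕ) : ZMod q :=
  if (fstF (fstF y)).length = n then ((decodeNat (fstF (sndF^[i'] (sndF (fstF y)))) : ℕ) : ZMod q) else 0

/-- `decodeSecret` is `secOf`, coordinatewise. [folklore] -/
theorem decodeSecret_apply (hi : i' < n) : decodeSecret n q y ⟨i', hi⟩ = secOf n q y i' := by
  rw [S2D.decodeSecret_eq, secOf]
  split_ifs <;> rfl

variable {S j c y i'}

/-- **Value of `tvalU` on a piece context**: `bin tᵢ'` (the shift is read off the root only).
[cite: Regev2009, §4 Lemma 4.1 (proof)] -/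
theorem tvalU_pOf (hm : 0 < m) (hj : j < Kc (encodeLWESamples S)) (hi : i' < n) :
    tvalU (pOf S j c y i') = encodeNat (shiftOfCoins n q c ⟨i', hi⟩).val := by
  obtain ⟨hnz, -⟩ := bounds_zOf S j c hm
  have hl : (ones i').length = i' := List.length_replicate
  rw [tvalU]
  simp only [Function.comp_apply, fanoutFn_apply, rootU_pOf, ipU_pOf]
  rw [rulerZ_zOf S j c hm, cZ_zOf S j c hj, bqZ_zOf, lenBinF_apply, chunkF_apply, bitsToNat_encodeNat, hl,
    min_eq_left (hi.le.trans hnz), remFn_boolPair, bitsToNat_encodeNat, shiftOfCoins]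
  rw [chunkVal, ZMod.val_natCast, chunk]

/-- **Value of `itemP`**: item `i'` of the raw body, by iterated tails. [folklore] -/
theorem itemP_pOf (hm : 0 < m) (hi : i' < n) : itemP (pOf S j c y i') = fstF (sndF^[i'] (sndF (fstF y))) := by
  obtain ⟨hnz, -⟩ := bounds_zOf S j c hm
  have hl : (ones i').length = i' := List.length_replicate
  rw [itemP, Function.comp_apply, fanoutFn_apply, fanoutFn_apply, Function.comp_apply, zP_pOf, ipU_pOf, lenBinF_apply, hl]
  simp only [secBodyP, Function.comp_apply, yP_pOf]
  rw [nthLF, Function.comp_apply, dropLF_record, activeRounds_encodeNat, min_eq_left (hi.le.trans hnz)]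

/-- Value of `condP`: the length test. [folklore] -/
theorem condP_pOf : condP (pOf S j c y i') = [decide ((fstF (fstF y)).length = n)] := by
  simp only [condP, Function.comp_apply, fanoutFn_apply, secCntP, yP_pOf, zP_pOf, bnZ_zOf, lenBinF_apply, eqValFn_boolPair,
    bitsToNat_encodeNat]

/-- **Value of `sModP`**: `bin (s'ᵢ'.val)`. [folklore] -/
theorem sModP_pOf (hm : 0 < m) (hi : i' < n) : sModP (pOf S j c y i') = encodeNat (secOf n q y i').val := by
  rw [sModP, iteFn_apply condP_pOf, secOf]
  by_cases h : (fstF (fstF y)).length = n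
  · rw [decide_eq_true h, if_pos rfl, if_pos h, Function.comp_apply, fanoutFn_apply, sValP, Function.comp_apply,
      itemP_pOf hm hi, Function.comp_apply, zP_pOf, bqZ_zOf, remFn_boolPair, bitsToNat_encodeNat, bitsToNat_canonF,
      ZMod.val_natCast]
  · rw [decide_eq_false h, if_neg h, ZMod.val_zero]
    rfl

/-- The subtraction identity: `((q − t.val) + s.val) mod q = (s − t).val`. [folklore] -/
theorem sub_val_eq [NeZero q] (s t : ZMod q) : (q - t.val + s.val) % q = (s - t).val := by
  rw [← ZMod.val_natCast]
  congr 1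
  rw [Nat.cast_add, Nat.cast_sub (ZMod.val_lt t).le, ZMod.natCast_self, ZMod.natCast_zmod_val, ZMod.natCast_zmod_val]
  ring

/-- **Value of `vP`**: `bin (s'ᵢ' − tᵢ').val`. [cite: Regev2009, §4 Lemma 4.1 (proof)] -/
theorem vP_pOf [NeZero q] (hm : 0 < m) (hj : j < Kc (encodeLWESamples S)) (hi : i' < n) :
    vP (pOf S j c y i') = encodeNat (secOf n q y i' - shiftOfCoins n q c ⟨i', hi⟩).val := by
  rw [vP, Function.comp_apply, fanoutFn_apply, Function.comp_apply, fanoutFn_apply, Function.comp_apply, fanoutFn_apply,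
    tvalU_pOf hm hj hi, sModP_pOf hm hi]
  simp only [Function.comp_apply, zP_pOf, bqZ_zOf, subFn_boolPair, addFn_boolPair, remFn_boolPair, bitsToNat_encodeNat]
  rw [sub_val_eq]

/-- Value of `secFrameP` (raw index). [folklore] -/
theorem secFrameP_apply [NeZero q] (hm : 0 < m) (hj : j < Kc (encodeLWESamples S)) (hi : i' < n) :
    secFrameP (boolPair (wOf S j c y) (ones i')) =
      boolPair (encodeNat (secOf n q y i' - shiftOfCoins n q c ⟨i', hi⟩).val) [] := by
  rw [secFrameP, fanoutFn_apply, ← show pOf S j c y i' = boolPair (wOf S j c y) (ones i') from rfl, vP_pOf hm hj hi]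

/-- **Value of `secFramesW`**: the framed coordinates of `decodeSecret n q y − t`. [cite: Regev2009, §4 Lemma 4.1 (proof)] -/
theorem secFramesW_apply [NeZero q] (hm : 0 < m) (hj : j < Kc (encodeLWESamples S)) :
    secFramesW (wOf S j c y) =
      frames (List.ofFn fun i' : Fin n => encodeNat (decodeSecret n q y i' - shiftOfCoins n q c i').val) := by
  obtain ⟨hnz, hqz, -⟩ := bounds_zOf S j c hm
  have hnw : n ≤ (X : Polynomial ℕ).eval (wOf S j c y).length := by
    rw [eval_X, wOf_eq, length_boolPair]; omega
  rw [secFramesW, Function.comp_apply, Function.comp_apply, loopRec_apply]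
  simp only [Function.comp_apply, wOf_eq, fstF_boolPair, bnZ_zOf]
  rw [← wOf_eq, foldLoop_apply _ _ hnw, sndPow_succ_boolPair, sndPow_succ_boolPair, sndPow_zero, sndF_boolPair, foldAcc_clipF,
    foldAcc_appF, List.nil_append, frames_ofFn_eq_ccat']
  · refine ccat_congr fun i hi => ?_
    rw [zero_add, secFrameP_apply hm hj hi, dif_pos hi, decodeSecret_apply]
  · intro i _ hi
    rw [zero_add] at hi
    rw [secFrameP_apply hm hj hi, length_boolPair, List.length_nil, wOf_eq, length_boolPair]
    have := length_encodeNat_val_le (secOf n q y i - shiftOfCoins n q c ⟨i, hi⟩)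
    omega

/-- **`encodeSecret` field by field**: `⟨⟨1ⁿ, ⟪bin (s i).val⟫ᵢ⟩, ε⟩`. [folklore] -/
theorem encodeSecret_eq (s : Fin n → ZMod q) :
    encodeSecret s = boolPair (boolPair (ones n) (encList (List.ofFn fun i => encodeNat (s i).val))) [] := by
  unfold encodeSecret
  rw [encodingFinVec_encode_eq]
  rfl

/-- **The answer map meets its specification**: on `⟨zOf S j c, y⟩` it returns the canonical code of
`decodeSecret n q y − t`, for EVERY answer string `y`. [cite: Regev2009, §4 Lemma 4.1 (proof: the solver's answer minus t)] -/
theorem answerG_apply [NeZero q] (hm : 0 < m) (hj : j < Kc (encodeLWESamples S)) :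
    answerG (wOf S j c y) = encodeSecret (decodeSecret n q y - shiftOfCoins n q c) := by
  rw [answerG, fanoutFn_apply, fanoutFn_apply, secFramesW_apply hm hj, encodeSecret_eq, frames_eq_encList]
  simp only [Function.comp_apply, wOf_eq, fstF_boolPair, onesNZ_zOf S j c hm, Pi.sub_apply]

/-- **If the solver's answer decodes to the shifted secret `s + t`, the attempt returns the code of
`s`.** [cite: Regev2009, §4 Lemma 4.1 (proof)] -/
theorem answerG_apply_of_decode [NeZero q] (hm : 0 < m) (hj : j < Kc (encodeLWESamples S)) {s : Fin n → ZMod q}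
    (hy : decodeSecret n q y = s + shiftOfCoins n q c) : answerG (wOf S j c y) = encodeSecret s := by
  rw [answerG_apply hm hj, hy, add_sub_cancel_right]

end Values

end AmpBricks

end LWE

end Literature.Computability.Cryptography
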